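import Summits.BirchSwinnertonDyer.BirchSwinnertonDyer.Theorems.AlignedTransportAtTwoMainConjectureTransportAlignedAtTwoDeltaPosJacobian
import HarnessLib

/-!
# Crux C1 `MainConjectureTransportAlignedAtTwo` (stmt-BirchSwinnertonDyer-22296), line `birth`, residual (R2) `stub_lamLawKilford` (Kilford stratum):
# A COMMON SUBGROUP OF INDEX `≤ 4` IN BOTH HALF-KERNELS ⟹ THE SAME-KERNEL HYPOTHESIS `hker` (width seat att-p4 g16; `--supports 22296`)

THEOREMS ONLY (no `def`, no `sorry`, no named fact). CONDITIONAL on a carrier instance `J : ModularJacobianGaloisData N ι` (hypothesis; typing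
ask T1, named fact `nonempty_modularJacobianGaloisData`). BSD is not proved by this; C1 is not closed by this; `stub_lamLawKilford` is NOT
discharged by this.

WHY. Every equal-conductor capstone of (R2) in the tree (att-p3 g15 `…KilfordCopyTransport.jacobiMap_half_transport_of_ker_iff` p672990,
`…KilfordCopyNegDisc.lamLawKilford_of_conductorNorm_eq_of_ker_iff` p674335, `…KilfordCopyConductorOfFacts` p677700) consumes the SAME-KERNEL
hypothesis `hker : ∀ x ∈ Λ, D₁.jacobiMap [x/2] = 0 ↔ D₂.jacobiMap [x/2] = 0` on `Λ = H₁(X₀(N);ℤ)` («the two curves occupy the same copy of `ρ̄`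
in `J₀(N)[2]`»). What the intersection pairing can deliver (sibling file `…KilfordCopyOrthogonal`: the Weil-pairing adjunction
`ker(πᵢ|J₀(N)[2]) ⊇ (copyᵢ)^⊥`) is only a COMMON subgroup `Q ≤ Λ` lying in BOTH half-kernels, of index at most `4` — equality of the two kernels
then needs the index of each kernel to be exactly `4`, i.e. the SURJECTIVITY of `θᵢ : Λ → Wᵢ[2]`, which is Galois theory (`Wᵢ[2]` irreducible: no
rational `2`-torsion abscissa) and lives on the carrier `J`. This file is that adapter:

* **`ker_iff_of_commonKernel`** — `J : ModularJacobianGaloisData N ι`; data `D₁ D₂` at ONE level `N` for `W₁ W₂` without rational `2`-torsion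
  abscissa; both Jacobi maps non-zero on some half-class (`hnz₁`, `hnz₂` — supplied downstream by the `μ = 0` theorems
  `…KilfordCopyNegDisc.exists_jacobiMap_half_ne_zero_of_Δ_neg` / `…KilfordCopyDeltaPos.exists_jacobiMap_half_ne_zero`); a subgroup `Q` of
  `Λ = periodHomologyHecke N` with `0 < [Λ : Q] ≤ 4` on which both `Dᵢ.jacobiMap [·/2]` vanish. THEN `hker` holds VERBATIM. Proof: the lead's
  (G1) `…DeltaPosGaloisPlane.ker_eq_of_equivariant_of_index_le_four` (an equivariant non-zero map into `W[2]` has kernel EQUAL to any subgroup of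
  index `≤ 4` inside it) applied to both `θᵢ`, built exactly as in p672990 §1. NO shared cubic field, NO `Δ`, NO Hecke-side input is needed.
* `ker_iff_of_commonKernel'` — the same with `Q` given as a subgroup of the ambient dual space contained in `Λ`, index counted in `Λ`.

References: Darmon–Diamond–Taylor 1995 §1.5, §1.7 [DarmonDiamondTaylor1995]; Silverman AEC III.§7 [SilvermanAEC2009]; Buzzard 2000 Prop. 2.4
[Buzzard2000LevelLoweringModTwo]; Kilford–Wiese 2008 Question 1.9 [KilfordWiese2008].
-/

noncomputable section

-- justification: the `Summit.BirchSwinnertonDyer.BirchSwinnertonDyer.…` path repeats a component (route-file convention)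
set_option linter.dupNamespace false
set_option autoImplicit false

open scoped MatrixGroups ModularForm NumberField Classical
open CongruenceSubgroup Complex WeierstrassCurve IsDedekindDomain Polynomial Module
open Literature.NumberTheory.EllipticCurves Literature.NumberTheory.EllipticCurves.ModularForms
open Literature.NumberTheory.EllipticCurves.Greenberg1999
open Summit.BirchSwinnertonDyer.Rank1Residual.F1Sign2
open Summit.BirchSwinnertonDyer.BirchSwinnertonDyer.Theorems.AlignedTransportAtTwoDeltaPosGaloisPlane
open Summit.BirchSwinnertonDyer.BirchSwinnertonDyer.Theorems.AlignedTransportAtTwoDeltaPosJacobian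

namespace Summit.BirchSwinnertonDyer.BirchSwinnertonDyer.Theorems.AlignedTransportAtTwoKilfordCopyCommonKernel

variable {N : ℕ} [NeZero N]

/-! ## §1 The adapter: a common subgroup of index `≤ 4` in both half-kernels gives `hker` -/

/-- **A COMMON SUBGROUP OF INDEX `≤ 4` IN BOTH HALF-KERNELS ⟹ SAME KERNEL.** With the `ℚ`-structure carrier `J`, two parametrisation data
`D₁ D₂` at ONE level `N` of curves `W₁ W₂` without rational `2`-torsion abscissa, both Jacobi maps non-zero on some half-class `[x/2]`, and a
subgroup `Q` of `Λ = H₁(X₀(N);ℤ)` of finite index `≤ 4` on which both `Dᵢ.jacobiMap [·/2]` vanish: the two Jacobi maps have the SAME KERNEL on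
half-classes (each `θᵢ : Λ → Wᵢ[2]` is `Γ_ℚ`-equivariant and non-zero, hence onto the irreducible `Wᵢ[2]`, so `ker θᵢ ⊇ Q` has index `4 ∣ [Λ : Q] ≤ 4`
and `ker θ₁ = Q = ker θ₂`). Valid ON the Kilford stratum (no multiplicity one is used). [cite: DarmonDiamondTaylor1995, §1.5 and §1.7]
[cite: SilvermanAEC2009, III.§7] [cite: Buzzard2000LevelLoweringModTwo, Prop. 2.4] -/
theorem ker_iff_of_commonKernel (ι : AlgebraicClosure ℚ →+* ℂ) (J : ModularJacobianGaloisData N ι)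
    {W₁ W₂ : WeierstrassCurve ℚ} [W₁.IsElliptic] [W₂.IsElliptic]
    (D₁ : ModularParametrizationData W₁ N) (D₂ : ModularParametrizationData W₂ N)
    (ht₁ : ∀ x : ℚ, ¬ HasRationalTwoTorsionX W₁ x) (ht₂ : ∀ x : ℚ, ¬ HasRationalTwoTorsionX W₂ x)
    (hnz₁ : ∃ x ∈ periodHomology N, D₁.jacobiMap (Submodule.Quotient.mk ((2 : ℂ)⁻¹ • x)) ≠ 0)
    (hnz₂ : ∃ x ∈ periodHomology N, D₂.jacobiMap (Submodule.Quotient.mk ((2 : ℂ)⁻¹ • x)) ≠ 0)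
    (Q : AddSubgroup (periodHomologyHecke N)) (hQ0 : Q.index ≠ 0) (hQ4 : Q.index ≤ 4)
    (hQ₁ : ∀ z ∈ Q, D₁.jacobiMap (Submodule.Quotient.mk ((2 : ℂ)⁻¹ • (z : Module.Dual ℂ (CuspForm (Gamma0 N) 2)))) = 0)
    (hQ₂ : ∀ z ∈ Q, D₂.jacobiMap (Submodule.Quotient.mk ((2 : ℂ)⁻¹ • (z : Module.Dual ℂ (CuspForm (Gamma0 N) 2)))) = 0) :
    ∀ x ∈ periodHomology N,
      D₁.jacobiMap (Submodule.Quotient.mk ((2 : ℂ)⁻¹ • x)) = 0 ↔ D₂.jacobiMap (Submodule.Quotient.mk ((2 : ℂ)⁻¹ • x)) = 0 := by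
  -- `Λ = periodHomologyHecke N` as the `𝕋_ℤ`-module (same carrier as `periodHomology N`)
  have memΛ : ∀ z : periodHomologyHecke N, (z : Module.Dual ℂ (CuspForm (Gamma0 N) 2)) ∈ periodHomology N := fun z ↦
    (mem_periodHomologyHecke N).mp z.2
  let half : Module.Dual ℂ (CuspForm (Gamma0 N) 2) → J0 N := fun z ↦ Submodule.Quotient.mk ((2 : ℂ)⁻¹ • z)
  have half_add : ∀ z z', half (z + z') = half z + half z' := fun z z' ↦ by
    simp only [half, smul_add, Submodule.Quotient.mk_add]
  -- the maps `θᵢ : Λ → Wᵢ[2]` through `existsUnique_geomTorsion_eq`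
  have hex₁ : ∀ z : periodHomologyHecke N, ∃! P : geomTorsion W₁ (2 : ℤ), W₁.geomPointsToComplex ι (P : W₁.geomPoints) = D₁.jacobiMap (half z) :=
    fun z ↦ existsUnique_geomTorsion_eq W₁ ι (jacobiMap_half_add_self D₁ (memΛ z))
  have hex₂ : ∀ z : periodHomologyHecke N, ∃! P : geomTorsion W₂ (2 : ℤ), W₂.geomPointsToComplex ι (P : W₂.geomPoints) = D₂.jacobiMap (half z) :=
    fun z ↦ existsUnique_geomTorsion_eq W₂ ι (jacobiMap_half_add_self D₂ (memΛ z))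
  choose θ₁f hθ₁f using fun z ↦ (hex₁ z).exists
  choose θ₂f hθ₂f using fun z ↦ (hex₂ z).exists
  have uniq₁ : ∀ (z : periodHomologyHecke N) (P : geomTorsion W₁ (2 : ℤ)), W₁.geomPointsToComplex ι (P : W₁.geomPoints) = D₁.jacobiMap (half z) → P = θ₁f z :=
    fun z P hP ↦ (hex₁ z).unique hP (hθ₁f z)
  have uniq₂ : ∀ (z : periodHomologyHecke N) (P : geomTorsion W₂ (2 : ℤ)), W₂.geomPointsToComplex ι (P : W₂.geomPoints) = D₂.jacobiMap (half z) → P = θ₂f z :=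
    fun z P hP ↦ (hex₂ z).unique hP (hθ₂f z)
  let θ₁ : periodHomologyHecke N →+ geomTorsion W₁ (2 : ℤ) :=
    { toFun := θ₁f
      map_zero' := by
        symm; apply uniq₁
        have h0 : half 0 = 0 := by simp only [half, smul_zero, Submodule.Quotient.mk_zero]
        rw [ZeroMemClass.coe_zero, map_zero, ZeroMemClass.coe_zero, h0, map_zero]
      map_add' := fun z z' ↦ by
        symm; apply uniq₁
        rw [AddSubgroup.coe_add, map_add, hθ₁f, hθ₁f, Submodule.coe_add, half_add, map_add] }
  let θ₂ : periodHomologyHecke N →+ geomTorsion W₂ (2 : ℤ) :=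
    { toFun := θ₂f
      map_zero' := by
        symm; apply uniq₂
        have h0 : half 0 = 0 := by simp only [half, smul_zero, Submodule.Quotient.mk_zero]
        rw [ZeroMemClass.coe_zero, map_zero, ZeroMemClass.coe_zero, h0, map_zero]
      map_add' := fun z z' ↦ by
        symm; apply uniq₂
        rw [AddSubgroup.coe_add, map_add, hθ₂f, hθ₂f, Submodule.coe_add, half_add, map_add] }
  have hθ₁_apply : ∀ z, θ₁ z = θ₁f z := fun _ ↦ rfl
  have hθ₂_apply : ∀ z, θ₂ z = θ₂f z := fun _ ↦ rfl
  -- kernels in `jacobiMap` currency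
  have hker₁ : ∀ z : periodHomologyHecke N, θ₁ z = 0 ↔ D₁.jacobiMap (half z) = 0 := by
    intro z
    constructor
    · intro h
      have := hθ₁f z
      rw [← hθ₁_apply, h, ZeroMemClass.coe_zero, map_zero] at this
      exact this.symm
    · intro h
      rw [hθ₁_apply]; symm; apply uniq₁
      rw [ZeroMemClass.coe_zero, map_zero]; exact h.symm
  have hker₂ : ∀ z : periodHomologyHecke N, θ₂ z = 0 ↔ D₂.jacobiMap (half z) = 0 := by
    intro z
    constructor
    · intro h
      have := hθ₂f z
      rw [← hθ₂_apply, h, ZeroMemClass.coe_zero, map_zero] at this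
      exact this.symm
    · intro h
      rw [hθ₂_apply]; symm; apply uniq₂
      rw [ZeroMemClass.coe_zero, map_zero]; exact h.symm
  -- the torsion points `⟨half z⟩ ∈ J0.tors N` and the lifted Galois action on `Λ`
  have htors : ∀ z : periodHomologyHecke N, half z ∈ J0.tors N := fun z ↦ by
    rw [J0.mem_tors_iff, isOfFinAddOrder_iff_nsmul_eq_zero]
    exact ⟨2, two_pos, by rw [two_nsmul]; exact half_add_half_eq_zero (memΛ z)⟩
  have hlift : ∀ (σ : Field.absoluteGaloisGroup ℚ) (z : periodHomologyHecke N), ∃ z' : periodHomologyHecke N,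
      half z' = ((J.galAct σ ⟨half z, htors z⟩ : J0.tors N) : J0 N) := by
    intro σ z
    set t : J0.tors N := J.galAct σ ⟨half z, htors z⟩ with ht
    have htt : (t : J0 N) + (t : J0 N) = 0 := by
      rw [← Submodule.coe_add, ht, ← map_add]
      have : (⟨half z, htors z⟩ : J0.tors N) + ⟨half z, htors z⟩ = 0 := Subtype.ext (half_add_half_eq_zero (memΛ z))
      rw [this, map_zero, Submodule.coe_zero]
    obtain ⟨z', hz', hz'eq⟩ := exists_half_eq htt
    exact ⟨⟨z', (mem_periodHomologyHecke N).mpr hz'⟩, hz'eq⟩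
  choose act hact using hlift
  -- equivariance
  have hθ₁ : ∀ (σ : Field.absoluteGaloisGroup ℚ) (z : periodHomologyHecke N), θ₁ (act σ z) = σ • θ₁ z := by
    intro σ z
    symm
    rw [hθ₁_apply, hθ₁_apply]
    apply uniq₁
    rw [AddSubgroup.torsionBy.coe_smul, hact σ z]
    exact (J.jacobiMap_galAct W₁ D₁ σ ⟨half z, htors z⟩ (θ₁f z : W₁.geomPoints) (hθ₁f z).symm).symm
  have hθ₂ : ∀ (σ : Field.absoluteGaloisGroup ℚ) (z : periodHomologyHecke N), θ₂ (act σ z) = σ • θ₂ z := by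
    intro σ z
    symm
    rw [hθ₂_apply, hθ₂_apply]
    apply uniq₂
    rw [AddSubgroup.torsionBy.coe_smul, hact σ z]
    exact (J.jacobiMap_galAct W₂ D₂ σ ⟨half z, htors z⟩ (θ₂f z : W₂.geomPoints) (hθ₂f z).symm).symm
  -- non-vanishing of `θ₁` and `θ₂`
  have h0₁ : ∃ z, θ₁ z ≠ 0 := by
    obtain ⟨z, hz, hne⟩ := hnz₁
    exact ⟨⟨z, (mem_periodHomologyHecke N).mpr hz⟩, fun h0 ↦ hne ((hker₁ ⟨z, _⟩).mp h0)⟩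
  have h0₂ : ∃ z, θ₂ z ≠ 0 := by
    obtain ⟨z, hz, hne⟩ := hnz₂
    exact ⟨⟨z, (mem_periodHomologyHecke N).mpr hz⟩, fun h0 ↦ hne ((hker₂ ⟨z, _⟩).mp h0)⟩
  -- `Q` lies in both kernels, hence IS both kernels (index `4 ∣ [Λ : Q] ≤ 4`)
  have hQ₁' : Q ≤ θ₁.ker := fun z hz ↦ by
    rw [AddMonoidHom.mem_ker, hker₁]; exact hQ₁ z hz
  have hQ₂' : Q ≤ θ₂.ker := fun z hz ↦ by
    rw [AddMonoidHom.mem_ker, hker₂]; exact hQ₂ z hz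
  have hK₁ : θ₁.ker = Q := ker_eq_of_equivariant_of_index_le_four ht₁ act θ₁ hθ₁ h0₁ Q hQ₁' hQ0 hQ4
  have hK₂ : θ₂.ker = Q := ker_eq_of_equivariant_of_index_le_four ht₂ act θ₂ hθ₂ h0₂ Q hQ₂' hQ0 hQ4
  -- conclude at `x`
  intro x hx
  have hz : (⟨x, (mem_periodHomologyHecke N).mpr hx⟩ : periodHomologyHecke N) ∈ θ₁.ker ↔ (⟨x, (mem_periodHomologyHecke N).mpr hx⟩ : periodHomologyHecke N) ∈ θ₂.ker := by
    rw [hK₁, hK₂]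
  rw [AddMonoidHom.mem_ker, AddMonoidHom.mem_ker, hker₁, hker₂] at hz
  exact hz

/-! ## §2 Bookkeeping: the same with `Q` a subgroup of the ambient dual space inside `Λ` -/

/-- **Variant with `Q` given inside the ambient dual space.** If `Q ≤ Λ = H₁(X₀(N);ℤ)` (as subgroups of `S₂(Γ₀(N))^∨`) has index in `Λ` finite
and `≤ 4` and both `Dᵢ.jacobiMap [·/2]` vanish on `Q`, then `hker`. [cite: DarmonDiamondTaylor1995, §1.5 and §1.7]
[cite: Buzzard2000LevelLoweringModTwo, Prop. 2.4] -/
theorem ker_iff_of_commonKernel' (ι : AlgebraicClosure ℚ →+* ℂ) (J : ModularJacobianGaloisData N ι)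
    {W₁ W₂ : WeierstrassCurve ℚ} [W₁.IsElliptic] [W₂.IsElliptic]
    (D₁ : ModularParametrizationData W₁ N) (D₂ : ModularParametrizationData W₂ N)
    (ht₁ : ∀ x : ℚ, ¬ HasRationalTwoTorsionX W₁ x) (ht₂ : ∀ x : ℚ, ¬ HasRationalTwoTorsionX W₂ x)
    (hnz₁ : ∃ x ∈ periodHomology N, D₁.jacobiMap (Submodule.Quotient.mk ((2 : ℂ)⁻¹ • x)) ≠ 0)
    (hnz₂ : ∃ x ∈ periodHomology N, D₂.jacobiMap (Submodule.Quotient.mk ((2 : ℂ)⁻¹ • x)) ≠ 0)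
    (Q : AddSubgroup (Module.Dual ℂ (CuspForm (Gamma0 N) 2))) (hQΛ : Q ≤ periodHomology N)
    (hQ0 : (Q.addSubgroupOf (periodHomologyHecke N).toAddSubgroup).index ≠ 0)
    (hQ4 : (Q.addSubgroupOf (periodHomologyHecke N).toAddSubgroup).index ≤ 4)
    (hQ₁ : ∀ x ∈ Q, D₁.jacobiMap (Submodule.Quotient.mk ((2 : ℂ)⁻¹ • x)) = 0)
    (hQ₂ : ∀ x ∈ Q, D₂.jacobiMap (Submodule.Quotient.mk ((2 : ℂ)⁻¹ • x)) = 0) :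
    ∀ x ∈ periodHomology N,
      D₁.jacobiMap (Submodule.Quotient.mk ((2 : ℂ)⁻¹ • x)) = 0 ↔ D₂.jacobiMap (Submodule.Quotient.mk ((2 : ℂ)⁻¹ • x)) = 0 := by
  have _ := hQΛ
  refine ker_iff_of_commonKernel ι J D₁ D₂ ht₁ ht₂ hnz₁ hnz₂ (Q.addSubgroupOf (periodHomologyHecke N).toAddSubgroup) hQ0 hQ4
    (fun z hz ↦ hQ₁ _ ?_) (fun z hz ↦ hQ₂ _ ?_)
  · exact AddSubgroup.mem_addSubgroupOf.mp hz
  · exact AddSubgroup.mem_addSubgroupOf.mp hz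

end Summit.BirchSwinnertonDyer.BirchSwinnertonDyer.Theorems.AlignedTransportAtTwoKilfordCopyCommonKernel

end
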